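import Summits.ResolutionOfSingularities.ResolutionOfSingularities.Theorems.FrobeniusClosingPatchingRelPerfectDepthOneTargets
import Summits.ResolutionOfSingularities.ResolutionOfSingularities.Theorems.FrobeniusClosingPatchingRelPerfectDepthOneTowerContractionHolds
import Summits.ResolutionOfSingularities.ResolutionOfSingularities.Theorems.FrobeniusClosingPatchingRelPerfectDepthOneDictionaryStepHolds
import Summits.ResolutionOfSingularities.ResolutionOfSingularities.Theorems.FrobeniusClosingPatchingRelPerfectDepthOneExceptionalPackage
import Summits.ResolutionOfSingularities.ResolutionOfSingularities.Theorems.FrobeniusClosingPatchingRelPerfectDepthOneDivisorialFactorizationHolds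
import Summits.ResolutionOfSingularities.ResolutionOfSingularities.Theorems.FrobeniusClosingPatchingRelPerfectDepthOneRegularizeSupportHolds
import Summits.ResolutionOfSingularities.ResolutionOfSingularities.Theorems.FrobeniusClosingPatchingRelPerfectDepthOnePrincipalizeControlled

/-!
# Crux `PatchingRelPerfect` (stmt-ResolutionOfSingularities-16161), chain W5.2 — programme r-d1 ASSEMBLED:
# the DEPTH-ONE RUNG `DepthOneConclusion` from the six landed targets, BY NAME

[OURS · L1 W5.2 · rung r-d1] CHAIN v1.5 §1 (A) / §2 row lead-2; plan-1's typed work breakdown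
`ChainW52TargetsE.lean` 9d67ec503d849faa = tree modules `…DepthOneTargetsDefs.lean` (p496180) +
`…DepthOneTargets.lean` (p496485, the proved compositions incl. `depthOne_of_targets'`). The six stub-sized
targets are CLOSED BY NAME in the tree:

* I1 `exceptionalPackage_holds` (res-L1-w52-stub-3 parts 1–2 p493964/p494999 + res-D-pv-055 p496054/p496769);
* D1 `dictionaryStep_holds` (res-D-pv-016 p495681/p496477);
* D5 `towerContraction_holds` (res-L1-w52-stub-3 p493249, closer p496616 by res-D-pv-009);
* S-A2 `divisorialFactorization_holds` (res-D-pv-059 p495358/p497002);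
* A2s `regularizeSupport_holds` (res-type-049 p496841 + closer `…RegularizeSupportHolds.lean`);
* A1 `DepthOne.principalizeControlled_holds` (res-type-003 p496767/p497149).

This file is the 15-line ASSEMBLY announced in CHAIN v1.5 §0b.1: `depthOne` = `depthOne_of_targets'` applied to
the six `_holds`, i.e. **for every regular local ring `S` of Krull dimension four (any characteristic, any residue
field, no completeness, no excellence of `S`), every family `x` spanning `𝔪`, every `I ≠ 0` of EXCEPTIONAL DEPTH
ONE and every blowing up `T → Spec S` along `I`, there is a non-zero ideal sheaf on `T` cosupported in the closed
fibre whose blowing up is regular — MODULO the two printed dimension-three theorems** CP 2019 Prop. 4.4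
(`CossartPiltant2019Principalization`, F-31) and CJS 2020 Thm. 1.4 / 6.9 (a) in the corrected sequence form
(`CossartJannsenSaito2020EmbeddedSequenceB`, F-32bR), which enter as hypotheses and nowhere as axioms. Also
recorded: Piece B (the fourfold dictionary) is now an UNCONDITIONAL theorem (`dictionaryPiece_holds :
ControlledTrivialization₃ → DepthOneConclusion`), and Piece A gives Θ₃ modulo the two facts
(`controlledTrivialization₃_of_facts`). This is FORMAT evidence for the registered core `stub_atomDimFourBlowup`
on its depth-one stratum (CHAIN §3 rung ledger), not a re-cut of the registered stub and not a statement of the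
manuscript under review; the located open content of the core (kernel sentence v1.4: ≥ 2 layers non-graded /
≥ 3 layers graded) is untouched. AI-assembled; AI review is weaker than expert review.

## References
* V. Cossart, O. Piltant, J. Algebra 529 (2019), Prop. 4.4. [CossartPiltant2019]
* V. Cossart, U. Jannsen, S. Saito, LNM 2270 (2020), Thm. 1.4, Cor. 1.5, Thm. 6.9 (a). [CossartJannsenSaito2020]
* J. Kollár, *Lectures on Resolution of Singularities* (2007), (3.111) Step 3. [Kollar2007]
* The Stacks Project, Tags 080A, 080B, 0BIA. [StacksProject]
-/

-- `Summit.<Summit>.<Sub>.Theorems` with `Sub = Summit` (single-conjunct summit, D-0017)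
set_option linter.dupNamespace false

noncomputable section

open CategoryTheory AlgebraicGeometry
open Literature.AlgebraicGeometry.Resolution

namespace Summit.ResolutionOfSingularities.ResolutionOfSingularities.Theorems.DepthOneTargets

universe u

/-- **Piece B holds unconditionally**: the fourfold dictionary `Θ₃ → DepthOneConclusion`, from the landed I1
(exceptional package), D1 (dictionary step) and D5 (tower contraction), the dictionary's end being proved in the
compositions file. Fact-free. [cite: Kollar2007, (3.111) Step 3] [cite: StacksProject, Tag 080A] -/
theorem dictionaryPiece_holds : DictionaryPiece.{u} :=
  dictionaryPiece_of_steps' exceptionalPackage_holds dictionaryStep_holds towerContraction_holds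

/-- **Θ₃ modulo the two printed dimension-three facts** (Piece A assembled): on a regular, excellent, integral
Noetherian threefold every non-zero ideal sheaf is carried to the unit ideal by a controlled sequence — CP
principalization (A1), CJS regularization of the support (A2s), divisorial factorisation (S-A2) and peeling.
[cite: CossartPiltant2019, Prop. 4.4] [cite: CossartJannsenSaito2020, Thm. 1.4, Cor. 1.5] -/
theorem controlledTrivialization₃_of_facts
    (hCP : CossartPiltant2019Principalization.{u}) (hCJS : CossartJannsenSaito2020EmbeddedSequenceB.{u}) :
    ControlledTrivialization₃.{u} :=
  trivializationPiece_of_steps DepthOne.principalizeControlled_holds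
    (regularizePeel_of_divisorial
      (regularizeDivisorial_of_support regularizeSupport_holds divisorialFactorization_holds)) hCP hCJS

/-- **r-d1 — THE DEPTH-ONE RUNG, ASSEMBLED BY NAME** (`depthOne_of_targets'` on the six landed targets): for `S`
regular local of Krull dimension `4`, `x` spanning `𝔪`, `I ≠ 0` of exceptional depth one and `f : T → Spec S` a
blowing up along `I`, there are a non-zero ideal sheaf `J` on `T` cosupported in the closed fibre and a blowing up
`T' → T` along `J` with `T'` regular — modulo CP 2019 Prop. 4.4 and CJS 2020 Thm. 1.4 / 6.9 (a) (sequence form B),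
taken as hypotheses. [cite: CossartPiltant2019, Prop. 4.4] [cite: CossartJannsenSaito2020, Thm. 1.4, Thm. 6.9 (a)]
[cite: Kollar2007, (3.111) Step 3] -/
theorem depthOne (hCP : CossartPiltant2019Principalization.{u})
    (hCJS : CossartJannsenSaito2020EmbeddedSequenceB.{u}) : DepthOneConclusion.{u} :=
  depthOne_of_targets' DepthOne.principalizeControlled_holds regularizeSupport_holds
    divisorialFactorization_holds exceptionalPackage_holds dictionaryStep_holds towerContraction_holds hCP hCJS

/-- **r-d1, unfolded to the registered core's binder shape on the depth-one stratum**: the conclusion of the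
registered open stub `stub_atomDimFourBlowup` — `∃ J T' π, J ≠ ⊥ ∧ Supp J over the closed point ∧ IsBlowup π J ∧
T' regular` — for every `I ≠ 0` of exceptional depth one over a regular local ring of Krull dimension four, with
NONE of the core's extra hypotheses (completeness, `CharP`, perfect residue field), modulo the two printed
dimension-three facts. [cite: CossartPiltant2019, Prop. 4.4] [cite: CossartJannsenSaito2020, Thm. 1.4, Thm. 6.9 (a)] -/
theorem depthOne_atom (hCP : CossartPiltant2019Principalization.{u})
    (hCJS : CossartJannsenSaito2020EmbeddedSequenceB.{u})
    (S : Type u) [CommRing S] [IsRegularLocalRing S] (hdim : ringKrullDim S = (4 : ℕ))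
    {n : ℕ} (x : Fin n → S) (hx : Ideal.span (Set.range x) = IsLocalRing.maximalIdeal S)
    (I : Ideal S) (hI : I ≠ ⊥) (hdepth : HasExceptionalDepthOne x I)
    (T : Scheme.{u}) (f : T ⟶ Spec (.of S)) (hf : IsBlowup f (affineBlowup.idealSheaf I)) :
    ∃ (J : T.IdealSheafData) (T' : Scheme.{u}) (π : T' ⟶ T), J ≠ ⊥ ∧
      (∀ t : T, t ∈ J.support → f.base t = IsLocalRing.closedPoint S) ∧
      IsBlowup π J ∧ Scheme.IsRegular T' :=
  depthOne hCP hCJS S hdim n x hx I hI hdepth T f hf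

/-- **r-d1 in COMPANION form (`𝒞`-membership of every depth-one ideal)**: for `S` regular local of Krull
dimension four, `x` spanning `𝔪` and `I ≠ 0` of exceptional depth one there is an `𝔪`-primary-or-unit ideal `Q`
(`𝔪ᵐ ≤ Q`) with a REGULAR blowing up of `Spec S` along `(I·Q)~` — the hunt's FORMAT (CHAIN §4, K5.2b) — modulo
the two printed dimension-three facts. Same route as `dictionaryPiece_of_steps` (I1, Θ₃ on the exceptional
threefold, `inv_along` D1, the dictionary's end), stopped at D5 `towerContraction_holds` instead of converting to
the blow-up form. [cite: CossartPiltant2019, Prop. 4.4] [cite: CossartJannsenSaito2020, Thm. 1.4, Thm. 6.9 (a)]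
[cite: StacksProject, Tag 080A] -/
theorem depthOne_companion (hCP : CossartPiltant2019Principalization.{u})
    (hCJS : CossartJannsenSaito2020EmbeddedSequenceB.{u})
    (S : Type u) [CommRing S] [IsRegularLocalRing S] (hdim : ringKrullDim S = (4 : ℕ))
    {n : ℕ} (x : Fin n → S) (hx : Ideal.span (Set.range x) = IsLocalRing.maximalIdeal S)
    (I : Ideal S) (hI : I ≠ ⊥) (hdepth : HasExceptionalDepthOne x I) :
    ∃ (Q : Ideal S) (m : ℕ), IsLocalRing.maximalIdeal S ^ m ≤ Q ∧
      ∃ (B : Scheme.{u}) (b : B ⟶ Spec (.of S)),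
        IsBlowup b (affineBlowup.idealSheaf (I * Q)) ∧ Scheme.IsRegular B := by
  obtain ⟨X, E, g, i, 𝔟, hinv, hint, hnoeth, hexc, hdimE⟩ :=
    exceptionalPackage_holds S hdim n x hx I hI hdepth
  have key : ∃ (X' : Scheme.{u}) (g' : X' ⟶ Spec (.of S)),
      (∃ K : (Spec (.of S)).IdealSheafData, IsBlowup g' K ∧
        (K.support : Set (Spec (.of S))) ⊆ {IsLocalRing.closedPoint S}) ∧
      Scheme.IsRegular X' ∧ IsLocallyPrincipal ((affineBlowup.idealSheaf I).comap g') := by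
    by_cases h𝔟 : 𝔟 = ⊥
    · exact ⟨X, g, hinv.exists_isBlowup_supported, hinv.isRegular,
        dictionaryEnd_holds S I E X i g 𝔟 hinv (Or.inr h𝔟)⟩
    · haveI := hint
      haveI := hnoeth
      obtain ⟨E', ρ, hρ⟩ :=
        controlledTrivialization₃_of_facts hCP hCJS E hinv.isRegular_exc hexc hdimE 𝔟 h𝔟
      obtain ⟨X', i', g', hinv'⟩ := inv_along dictionaryStep_holds hρ X i g hinv
      exact ⟨X', g', hinv'.exists_isBlowup_supported, hinv'.isRegular,
        dictionaryEnd_holds S I E' X' i' g' ⊤ hinv' (Or.inl rfl)⟩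
  obtain ⟨X', g', ⟨K, hg', hK⟩, hX', hlp⟩ := key
  exact towerContraction_holds S I hI X' g' K hg' hK hX' hlp

end Summit.ResolutionOfSingularities.ResolutionOfSingularities.Theorems.DepthOneTargets

end
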